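import Summits.BirchSwinnertonDyer.BirchSwinnertonDyer.Theorems.EisensteinPrimesMazurMCOnCellBTwistbackReverseEdgeTwoFields
import Literature.NumberTheory.EllipticCurves.QuadraticTwistKroneckerRootNumberProofs
import Literature.NumberTheory.QuadraticFields.FundamentalDiscriminant
import HarnessLib

/-!
# Crux 3 `MazurMCOnCellB` (stmt-BirchSwinnertonDyer-19033), line `twistback` v13b — THE CERTIFIED TWO-STEP GRAPH IS GRADED BY
# THE CONDUCTOR: `TwoStepAt p U W ⇒ N_U · D² ∣ N_W`, `D = |d_K d_{K″}| ≥ 77` (unconditional, every `p`; exact granted modularity)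

Width seat bsd-line-x2-p1-w6 (gen 24), cell `bsd-eis` (run/shared/lean/pub/bsd-eis/), 2026-08-30; part A of two
(part B `…TwistbackOutDegree`: out-degree ≥ 1 and infinite components); `--kind proof --supports stmt-BirchSwinnertonDyer-19033
--as helper`.

HONEST FRAMING. THEOREMS ONLY (no `def`, no named fact introduced, no `sorry`, no instance). Everything here is an UNCONDITIONAL
elementary fact about conductors of quadratic twists by Heegner discriminants, except `exists_conductorNorm_eq_mul_sq_of_twoStepAt`
(exactness of the grading, conditional on the Modularity Theorem in the form `exists_isNewformOf`) and `not_isIsogenous_of_transGen`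
(conditional on `nonempty_modularParametrizationData`, for «isogenous ⇒ same conductor»). Nothing about any `L`-value, Selmer group,
Ш, Mazur's main conjecture or BSD is asserted; the file closes no registered stub (twistback v13b's 6⁷
`stub_offSubrow_connectedShaUnitOrPartner` is the class-wide SUPPLY and stays open); no summit statement is proved; 0 cells / labels /
stubs / tiers move.

## What, and why it matters for the line

6⁷ speaks about the graph on globally minimal elliptic curves over `ℚ` whose edges are the certified Heegner two-steps
`TwoStepAt p W W″` (`…TwistbackTwoStepDefs`, w6 g3): `W —K→ Wd —K″→ W″`, `K` admissible for `W` with `r_an(W ⊗ χ_{d_K}) = 1`,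
`K″` admissible for `Wd` with `L(Wd ⊗ χ_{d_{K″}}, 1) ≠ 0`. The tree knows the far end is an even twist unramified at `p` (g3), that
`j`, the GV type and the split type at `p` are zig-zag invariants (ZigzagTwistFamily, ZigzagSplitType), that edges transport across
isogeny (TwoStepIsogenyInvariance), and that a REVERSE edge needs two fields supported on odd square primes of the target, so curves
with `≤ 1` odd additive prime have IN-degree `0` (w6 g22 / g23: `TwoStepAt.twoFields`). This file finishes the conductor
bookkeeping, prime by prime, EVERY `p`:

* `factorization_conductorNorm_of_data` — along the data `U —K→ Ud —K″→ W`: a prime of `d_K d_{K″}` has `ν_q(N_U) = 0` and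
  `ν_q(N_W) ≥ 2`; every other prime has `ν_q(N_U) = ν_q(N_W)` (in particular the Eisenstein prime keeps `p ‖ N`).
* `mul_sq_dvd_conductorNorm_of_data` / `exists_mul_sq_dvd_conductorNorm_of_twoStepAt` — **`N_U · D² ∣ N_W` with `D = |d_K|·|d_{K″}|`
  SQUAREFREE, `≥ 77`, prime to `N_U`** (the two discriminants are odd fundamental, `≤ −7`, coprime and distinct: a prime of `d_K`
  is additive for `Ud`, hence split in `K″`).
* hence `5929 · N_U ≤ N_W` (`conductorNorm_le_of_twoStepAt` — the every-`p` form of gen 21's `p = 13` door prices: EACH certified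
  edge multiplies the conductor by at least `77² = 5929`), `N_U ∣ N_W`, `N_U < N_W`, the multiplicative primes (`ν_q = 1`) are an
  EDGE INVARIANT (`factorization_eq_one_iff_of_twoStepAt`), exponents of old primes are unchanged (`factorization_eq_of_dvd_of_twoStepAt`);
* granted `exists_isNewformOf` the grading is EXACT: `N_W = N_U · D²`, `W ≅ U ⊗ χ_{d_K d_{K″}}` (`exists_conductorNorm_eq_mul_sq_of_twoStepAt`,
  from the tree's `rootNumber_quadraticTwist_of_emod_four_eq_one`);
* forward chains strictly raise the conductor (`conductorNorm_lt_of_transGen`), so THE GRAPH IS ACYCLIC (`not_transGen_twoStepAt_self`)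
  and a forward chain never returns to the isogeny class it left (`not_isIsogenous_of_transGen`).

Consequences drawn in part B: multiplicative primes are constant on 6⁷'s zig-zag components; every curve of conductor `< 5929`
(granted modularity `< 65219 = 11 · 77²`) is a SOURCE; with BFH + Hoffstein–Luo every root-number-`+1` vertex has OUT-degree `≥ 1`
and every component is infinite.

References: tree `…TwistbackTwoStepDefs`, `…TwistbackReverseEdgeTwoFields` (p770772), `…KernelCertP13NoReverseEdge` (p768810),
`…KernelCertP13DoorPriceClassI` (p766256), `…KernelCertP13DoorPrice` (p764408); B. Gross, in *`L`-functions and Arithmetic* (1991)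
§1 p. 235 [GrossLMS1991]; J. H. Silverman, AEC (2009) VII.5 Prop. 5.1, X.5 Cor. 5.4, App. C §16 [SilvermanAEC2009]; A. Atkin,
J. Lehner, Math. Ann. 185 (1970) Thm. 4 [AtkinLehner1970]; C. Breuil, B. Conrad, F. Diamond, R. Taylor, J. Amer. Math. Soc. 14 (2001)
Thm. A [BCDTJAMS2001].
-/

set_option autoImplicit false

-- `Summit.BirchSwinnertonDyer.BirchSwinnertonDyer.…`: the summit and its single sub-problem share a name.
set_option linter.dupNamespace false

noncomputable section

open scoped Classical

open WeierstrassCurve NumberField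
  Literature.NumberTheory.EllipticCurves
  Literature.NumberTheory.EllipticCurves.ModularForms
  Literature.NumberTheory.QuadraticFields
  Literature.NumberTheory.EllipticCurves.Rank1Residual
  Literature.NumberTheory.EllipticCurves.Rank1Residual.Typed
  IsDedekindDomain Rat.HeightOneSpectrum
  Summit.BirchSwinnertonDyer.Rank1Residual
  Summit.BirchSwinnertonDyer.BirchSwinnertonDyer.Theorems
  Summit.BirchSwinnertonDyer.BirchSwinnertonDyer.Theorems.EisensteinPrimesMazurMCOnCellBTwistbackTwoStepDefs
  Summit.BirchSwinnertonDyer.BirchSwinnertonDyer.Theorems.EisensteinPrimesMazurMCOnCellBKernelCertP13DoorPrice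
  Summit.BirchSwinnertonDyer.BirchSwinnertonDyer.Theorems.EisensteinPrimesMazurMCOnCellBKernelCertP13DoorPriceClassI
  Summit.BirchSwinnertonDyer.BirchSwinnertonDyer.Theorems.EisensteinPrimesMazurMCOnCellBKernelCertP13NoReverseEdge
  Summit.BirchSwinnertonDyer.BirchSwinnertonDyer.Theorems.EisensteinPrimesMazurMCOnCellBTwistbackReverseEdgeTwoFields

namespace Summit.BirchSwinnertonDyer.BirchSwinnertonDyer.Theorems.EisensteinPrimesMazurMCOnCellBTwistbackEdgeGrading

/-! ## §0 Arithmetic of odd Heegner discriminants -/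

/-- An odd quadratic discriminant is `≡ 1 (mod 4)` and squarefree (Stickelberger + fundamental discriminant; `|d| > 2`).
[folklore] -/
theorem discr_emod_four_eq_one_and_squarefree {K : Type} [Field K] [NumberField K] (hK : IsImaginaryQuadratic K)
    (hodd : Odd (NumberField.discr K)) :
    NumberField.discr K % 4 = 1 ∧ Squarefree (NumberField.discr K) := by
  rcases Quadratic.isFundamentalDiscriminant_discr (K := K) hK.1 with ⟨h1, hsq, -⟩ | ⟨h4, -, -⟩
  · exact ⟨h1, hsq⟩
  · exfalso
    rw [Int.odd_iff] at hodd
    omega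

/-- For an odd negative discriminant `d < −4` with `d ≡ 1 (mod 4)`: `|d| ≥ 7` and `|d| ≡ 3 (mod 4)`. [folklore] -/
theorem seven_le_natAbs_of_discr {d : ℤ} (hd4 : d % 4 = 1) (hlt : d < -4) : 7 ≤ d.natAbs ∧ d.natAbs % 4 = 3 := by
  omega

/-- Two DISTINCT natural numbers, both `≥ 7` and both `≡ 3 (mod 4)`, have product `≥ 77 = 7 · 11`. [folklore] -/
theorem seventySeven_le_mul {a b : ℕ} (ha : 7 ≤ a) (hb : 7 ≤ b) (ha4 : a % 4 = 3) (hb4 : b % 4 = 3) (hab : a ≠ b) :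
    77 ≤ a * b := by
  rcases Nat.lt_or_gt_of_ne hab with h | h
  · have hb11 : 11 ≤ b := by omega
    calc 77 = 7 * 11 := by norm_num
      _ ≤ a * b := Nat.mul_le_mul ha hb11
  · have ha11 : 11 ≤ a := by omega
    calc 77 = 11 * 7 := by norm_num
      _ ≤ a * b := Nat.mul_le_mul ha11 hb

/-! ## §1 GRADING: the conductor along a certified two-step edge (unconditional, every `p`) -/

/-- **The conductor exponents along the data of a two-step** `U —K→ Ud —K″→ W` (`U`, `Ud` globally minimal; `K` Heegner for
`N_U`, `K″` Heegner for `N_{Ud}`, both discriminants odd; `C₁ • Ud = U ⊗ χ_{d_K}`, `C₂ • W = Ud ⊗ χ_{d_{K″}}`), prime by prime: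
a prime `q` dividing `d_K d_{K″}` has `ν_q(N_U) = 0` and `ν_q(N_W) ≥ 2`; a prime dividing neither discriminant has
`ν_q(N_U) = ν_q(N_W)`. Assembled from gen 22's `sq_dvd_conductorNorm_of_dvd_discr`, gen 23's
`factorization_conductorNorm_eq_of_smul_eq_quadraticTwist` and `SatisfiesHeegnerHypothesis.not_dvd_discr`.
[cite: GrossLMS1991, §1 (p. 235)] [cite: SilvermanAEC2009, VII.5 Prop. 5.1(c), X.5 Cor. 5.4 and App. C §16] -/
theorem factorization_conductorNorm_of_data {U Ud W : WeierstrassCurve ℚ} [U.IsElliptic] [U.IsGloballyMinimal]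
    [Ud.IsElliptic] [Ud.IsGloballyMinimal] [W.IsElliptic]
    {K : Type} [Field K] [NumberField K] (hK : IsImaginaryQuadratic K)
    (hHN : SatisfiesHeegnerHypothesis (U.conductorNorm ℤ) K) (hodd : Odd (NumberField.discr K))
    {C₁ : VariableChange ℚ} (hC₁ : C₁ • Ud = U.quadraticTwist (NumberField.discr K : ℚ))
    {K'' : Type} [Field K''] [NumberField K''] (hK'' : IsImaginaryQuadratic K'')
    (hHN'' : SatisfiesHeegnerHypothesis (Ud.conductorNorm ℤ) K'') (hodd'' : Odd (NumberField.discr K''))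
    {C₂ : VariableChange ℚ} (hC₂ : C₂ • W = Ud.quadraticTwist (NumberField.discr K'' : ℚ))
    {q : ℕ} (hq : q.Prime) :
    (((q : ℤ) ∣ NumberField.discr K ∨ (q : ℤ) ∣ NumberField.discr K'') →
        (U.conductorNorm ℤ).factorization q = 0 ∧ 2 ≤ (W.conductorNorm ℤ).factorization q) ∧
      (¬ (q : ℤ) ∣ NumberField.discr K → ¬ (q : ℤ) ∣ NumberField.discr K'' →
        (U.conductorNorm ℤ).factorization q = (W.conductorNorm ℤ).factorization q) := by
  have hd4 : NumberField.discr K % 4 = 1 := (discr_emod_four_eq_one_and_squarefree hK hodd).1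
  have hd4'' : NumberField.discr K'' % 4 = 1 := (discr_emod_four_eq_one_and_squarefree hK'' hodd'').1
  -- transports at primes not dividing the twisting discriminant
  have hT₁ : ¬ (q : ℤ) ∣ NumberField.discr K →
      (Ud.conductorNorm ℤ).factorization q = (U.conductorNorm ℤ).factorization q :=
    fun hqd ↦ factorization_conductorNorm_eq_of_smul_eq_quadraticTwist hd4 hC₁ hq hqd
  have hT₂ : ¬ (q : ℤ) ∣ NumberField.discr K'' →
      (W.conductorNorm ℤ).factorization q = (Ud.conductorNorm ℤ).factorization q :=
    fun hqd'' ↦ factorization_conductorNorm_eq_of_smul_eq_quadraticTwist hd4'' hC₂ hq hqd''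
  refine ⟨fun hdvd ↦ ?_, fun hqd hqd'' ↦ by rw [← hT₁ hqd, ← hT₂ hqd'']⟩
  rcases hdvd with hqd | hqd''
  · -- FIRST discriminant: `q ∤ N_U` (Heegner), `q² ∣ N_{Ud}` (ramified twist of a good prime), `q ∤ d_{K″}` (Heegner for `N_{Ud}`)
    have hqU : ¬ q ∣ U.conductorNorm ℤ := fun hqN ↦
      Literature.SatisfiesHeegnerHypothesis.not_dvd_discr hK.1 hHN hq hqN hqd
    have hsqUd : q ^ 2 ∣ Ud.conductorNorm ℤ := sq_dvd_conductorNorm_of_dvd_discr hK hHN hodd hC₁ hq hqd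
    have hqUd : q ∣ Ud.conductorNorm ℤ := (dvd_pow_self q two_ne_zero).trans hsqUd
    have hqd'' : ¬ (q : ℤ) ∣ NumberField.discr K'' :=
      Literature.SatisfiesHeegnerHypothesis.not_dvd_discr hK''.1 hHN'' hq hqUd
    refine ⟨Nat.factorization_eq_zero_of_not_dvd hqU, ?_⟩
    rw [hT₂ hqd'']
    exact (hq.pow_dvd_iff_le_factorization (conductorNorm_pos_holds Ud).ne').mp hsqUd
  · -- SECOND discriminant: `q ∤ N_{Ud}` (Heegner), hence `q ∤ d_K` and `q ∤ N_U`; `q² ∣ N_W`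
    have hqUd : ¬ q ∣ Ud.conductorNorm ℤ := fun hqN ↦
      Literature.SatisfiesHeegnerHypothesis.not_dvd_discr hK''.1 hHN'' hq hqN hqd''
    have hqd : ¬ (q : ℤ) ∣ NumberField.discr K := fun hqd ↦
      hqUd ((dvd_pow_self q two_ne_zero).trans (sq_dvd_conductorNorm_of_dvd_discr hK hHN hodd hC₁ hq hqd))
    have hU0 : (U.conductorNorm ℤ).factorization q = 0 := by
      rw [← hT₁ hqd]; exact Nat.factorization_eq_zero_of_not_dvd hqUd
    exact ⟨hU0, (hq.pow_dvd_iff_le_factorization (conductorNorm_pos_holds W).ne').mp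
      (sq_dvd_conductorNorm_of_dvd_discr hK'' hHN'' hodd'' hC₂ hq hqd'')⟩

/-- **`N_U · (d_K d_{K″})² ∣ N_W` along the data of a two-step**, with `D = |d_K| · |d_{K″}|` squarefree, `≥ 77`, prime to `N_U`
(the two discriminants are odd, squarefree, `≤ −7`, coprime — a prime of `d_K` divides `N_{Ud}`, so splits in `K″` — and
distinct). Unconditional. [cite: GrossLMS1991, §1 (p. 235)] [cite: SilvermanAEC2009, X.5 Cor. 5.4 and App. C §16] -/
theorem mul_sq_dvd_conductorNorm_of_data {U Ud W : WeierstrassCurve ℚ} [U.IsElliptic] [U.IsGloballyMinimal]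
    [Ud.IsElliptic] [Ud.IsGloballyMinimal] [W.IsElliptic]
    {K : Type} [Field K] [NumberField K] (hK : IsImaginaryQuadratic K)
    (hHN : SatisfiesHeegnerHypothesis (U.conductorNorm ℤ) K) (hodd : Odd (NumberField.discr K))
    (hlt : NumberField.discr K < -4)
    {C₁ : VariableChange ℚ} (hC₁ : C₁ • Ud = U.quadraticTwist (NumberField.discr K : ℚ))
    {K'' : Type} [Field K''] [NumberField K''] (hK'' : IsImaginaryQuadratic K'')
    (hHN'' : SatisfiesHeegnerHypothesis (Ud.conductorNorm ℤ) K'') (hodd'' : Odd (NumberField.discr K''))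
    (hlt'' : NumberField.discr K'' < -4)
    {C₂ : VariableChange ℚ} (hC₂ : C₂ • W = Ud.quadraticTwist (NumberField.discr K'' : ℚ)) :
    U.conductorNorm ℤ * ((NumberField.discr K).natAbs * (NumberField.discr K'').natAbs) ^ 2 ∣ W.conductorNorm ℤ ∧
      Squarefree ((NumberField.discr K).natAbs * (NumberField.discr K'').natAbs) ∧
      77 ≤ (NumberField.discr K).natAbs * (NumberField.discr K'').natAbs ∧
      ((NumberField.discr K).natAbs * (NumberField.discr K'').natAbs).Coprime (U.conductorNorm ℤ) := by
  obtain ⟨hd4, hsq⟩ := discr_emod_four_eq_one_and_squarefree hK hodd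
  obtain ⟨hd4'', hsq''⟩ := discr_emod_four_eq_one_and_squarefree hK'' hodd''
  set a : ℕ := (NumberField.discr K).natAbs with ha
  set b : ℕ := (NumberField.discr K'').natAbs with hb
  have hF := fun (q : ℕ) (hq : q.Prime) ↦
    factorization_conductorNorm_of_data hK hHN hodd hC₁ hK'' hHN'' hodd'' hC₂ (q := q) hq
  -- coprimality of the two discriminants
  have hcop : a.Coprime b := by
    refine Nat.coprime_of_dvd fun q hq hqa hqb ↦ ?_
    have hqd : (q : ℤ) ∣ NumberField.discr K := Int.natCast_dvd.mpr (by rwa [ha] at hqa)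
    have hqd'' : (q : ℤ) ∣ NumberField.discr K'' := Int.natCast_dvd.mpr (by rwa [hb] at hqb)
    -- `q ∣ d_K ⇒ q² ∣ N_{Ud} ⇒ q ∤ d_{K″}`
    have hqUd : q ∣ Ud.conductorNorm ℤ :=
      (dvd_pow_self q two_ne_zero).trans (sq_dvd_conductorNorm_of_dvd_discr hK hHN hodd hC₁ hq hqd)
    exact Literature.SatisfiesHeegnerHypothesis.not_dvd_discr hK''.1 hHN'' hq hqUd hqd''
  have hsqa : Squarefree a := Int.squarefree_natAbs.mpr hsq
  have hsqb : Squarefree b := Int.squarefree_natAbs.mpr hsq''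
  have hsqab : Squarefree (a * b) := (Nat.squarefree_mul hcop).mpr ⟨hsqa, hsqb⟩
  -- size
  obtain ⟨ha7, ha3⟩ := seven_le_natAbs_of_discr hd4 hlt
  obtain ⟨hb7, hb3⟩ := seven_le_natAbs_of_discr hd4'' hlt''
  have hab : a ≠ b := by
    intro h
    have h1 : b = 1 := Nat.Coprime.eq_one_of_dvd (by simpa [h] using hcop : b.Coprime b) dvd_rfl
    omega
  have h77 : 77 ≤ a * b := seventySeven_le_mul ha7 hb7 ha3 hb3 hab
  -- coprimality with `N_U`
  have hcopN : (a * b).Coprime (U.conductorNorm ℤ) := by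
    refine Nat.coprime_of_dvd fun q hq hqab hqN ↦ ?_
    have hq' : (q : ℤ) ∣ NumberField.discr K ∨ (q : ℤ) ∣ NumberField.discr K'' := by
      rcases (Nat.Prime.dvd_mul hq).mp hqab with h | h
      · exact Or.inl (Int.natCast_dvd.mpr h)
      · exact Or.inr (Int.natCast_dvd.mpr h)
    have h0 := ((hF q hq).1 hq').1
    exact absurd h0 (hq.factorization_pos_of_dvd (conductorNorm_pos_holds U).ne' hqN).ne'
  -- divisibility, prime by prime
  refine ⟨?_, hsqab, h77, hcopN⟩
  have hU0 : U.conductorNorm ℤ ≠ 0 := (conductorNorm_pos_holds U).ne'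
  have hW0 : W.conductorNorm ℤ ≠ 0 := (conductorNorm_pos_holds W).ne'
  have hab0 : a * b ≠ 0 := by positivity
  have hab2 : (a * b) ^ 2 ≠ 0 := pow_ne_zero 2 hab0
  rw [← Nat.factorization_le_iff_dvd (mul_ne_zero hU0 hab2) hW0, Nat.factorization_mul hU0 hab2, Nat.factorization_pow]
  intro q
  simp only [Finsupp.coe_add, Finsupp.coe_smul, Pi.add_apply, Pi.smul_apply, smul_eq_mul]
  by_cases hq : q.Prime
  · by_cases hqab : q ∣ a * b
    · have hq' : (q : ℤ) ∣ NumberField.discr K ∨ (q : ℤ) ∣ NumberField.discr K'' := by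
        rcases (Nat.Prime.dvd_mul hq).mp hqab with h | h
        · exact Or.inl (Int.natCast_dvd.mpr h)
        · exact Or.inr (Int.natCast_dvd.mpr h)
      obtain ⟨h0, h2⟩ := (hF q hq).1 hq'
      have h1 : (a * b).factorization q = 1 := by
        have hle : (a * b).factorization q ≤ 1 := Squarefree.natFactorization_le_one q hsqab
        have hge : 1 ≤ (a * b).factorization q := (hq.dvd_iff_one_le_factorization hab0).mp hqab
        omega
      rw [h0, h1]; omega
    · have hq' : ¬ (q : ℤ) ∣ NumberField.discr K ∧ ¬ (q : ℤ) ∣ NumberField.discr K'' := by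
        constructor
        · exact fun h ↦ hqab ((Int.natCast_dvd.mp h).mul_right b)
        · exact fun h ↦ hqab ((Int.natCast_dvd.mp h).mul_left a)
      rw [(hF q hq).2 hq'.1 hq'.2, Nat.factorization_eq_zero_of_not_dvd hqab]; omega
  · simp [Nat.factorization_eq_zero_of_not_prime _ hq]

/-- **GRADING OF AN EDGE (unconditional, every `p`).** If `TwoStepAt p U W` then there is a squarefree `D ≥ 77`, prime to
`N_U`, with `N_U · D² ∣ N_W` — `D = |d_K d_{K″}|` for the edge's two fields. [cite: GrossLMS1991, §1 (p. 235)]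
[cite: SilvermanAEC2009, X.5 Cor. 5.4 and App. C §16] -/
theorem exists_mul_sq_dvd_conductorNorm_of_twoStepAt {p : ℕ} {U W : WeierstrassCurve ℚ} (h : TwoStepAt p U W) :
    ∃ D : ℕ, Squarefree D ∧ 77 ≤ D ∧ D.Coprime (U.conductorNorm ℤ) ∧ U.conductorNorm ℤ * D ^ 2 ∣ W.conductorNorm ℤ := by
  obtain ⟨_, _, _, _, K, _, _, hK, hHN, -, hodd, hlt, -, Ud, _, _, ⟨C₁, hC₁⟩, K'', _, _, hK'', hodd'', hlt'', hHN'', -, -,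
    ⟨C₂, hC₂⟩⟩ := h
  obtain ⟨hdvd, hsq, h77, hcop⟩ := mul_sq_dvd_conductorNorm_of_data hK hHN hodd hlt hC₁ hK'' hHN'' hodd'' hlt'' hC₂
  exact ⟨_, hsq, h77, hcop, hdvd⟩

/-- **Each certified two-step edge multiplies the conductor by at least `5929 = 77²`**: `TwoStepAt p U W ⇒ 5929 · N_U ≤ N_W`.
Unconditional, every `p` (the every-`p` form of gen 21's door prices). [cite: GrossLMS1991, §1 (p. 235)] -/
theorem conductorNorm_le_of_twoStepAt {p : ℕ} {U W : WeierstrassCurve ℚ} (h : TwoStepAt p U W) :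
    5929 * U.conductorNorm ℤ ≤ W.conductorNorm ℤ := by
  obtain ⟨_, _, hWE, _, -⟩ := id h
  obtain ⟨D, -, h77, -, hdvd⟩ := exists_mul_sq_dvd_conductorNorm_of_twoStepAt h
  have hle := Nat.le_of_dvd (conductorNorm_pos_holds W) hdvd
  have hD : 5929 ≤ D ^ 2 := by nlinarith
  calc 5929 * U.conductorNorm ℤ ≤ D ^ 2 * U.conductorNorm ℤ := Nat.mul_le_mul_right _ hD
    _ = U.conductorNorm ℤ * D ^ 2 := by ring
    _ ≤ W.conductorNorm ℤ := hle

/-- **`N_U ∣ N_W` along an edge.** Unconditional, every `p`. [cite: GrossLMS1991, §1 (p. 235)] -/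
theorem conductorNorm_dvd_of_twoStepAt {p : ℕ} {U W : WeierstrassCurve ℚ} (h : TwoStepAt p U W) :
    U.conductorNorm ℤ ∣ W.conductorNorm ℤ := by
  obtain ⟨D, -, -, -, hdvd⟩ := exists_mul_sq_dvd_conductorNorm_of_twoStepAt h
  exact (dvd_mul_right _ _).trans hdvd

/-- **`N_U < N_W` along an edge** — the certified two-step graph is GRADED by the conductor. Unconditional, every `p`.
[cite: GrossLMS1991, §1 (p. 235)] -/
theorem conductorNorm_lt_of_twoStepAt {p : ℕ} {U W : WeierstrassCurve ℚ} (h : TwoStepAt p U W) :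
    U.conductorNorm ℤ < W.conductorNorm ℤ := by
  obtain ⟨hUE, _, -⟩ := id h
  have hpos := conductorNorm_pos_holds U
  have := conductorNorm_le_of_twoStepAt h
  omega

/-- **Multiplicative primes are an EDGE INVARIANT**: along `TwoStepAt p U W`, `ν_q(N_U) = 1 ↔ ν_q(N_W) = 1` for every `q`
(old primes keep their exponent, new primes enter with exponent `≥ 2`). Unconditional, every `p`.
[cite: SilvermanAEC2009, VII.5 Prop. 5.1(c) and App. C §16] -/
theorem factorization_eq_one_iff_of_twoStepAt {p : ℕ} {U W : WeierstrassCurve ℚ} (h : TwoStepAt p U W) (q : ℕ) :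
    (U.conductorNorm ℤ).factorization q = 1 ↔ (W.conductorNorm ℤ).factorization q = 1 := by
  by_cases hq : q.Prime
  · obtain ⟨_, _, _, _, K, _, _, hK, hHN, -, hodd, -, -, Ud, _, _, ⟨C₁, hC₁⟩, K'', _, _, hK'', hodd'', -, hHN'', -, -,
      ⟨C₂, hC₂⟩⟩ := h
    have hF := factorization_conductorNorm_of_data hK hHN hodd hC₁ hK'' hHN'' hodd'' hC₂ (q := q) hq
    by_cases hqd : (q : ℤ) ∣ NumberField.discr K ∨ (q : ℤ) ∣ NumberField.discr K''
    · obtain ⟨h0, h2⟩ := hF.1 hqd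
      constructor <;> intro h1 <;> omega
    · push Not at hqd
      rw [hF.2 hqd.1 hqd.2]
  · simp [Nat.factorization_eq_zero_of_not_prime _ hq]

/-- **The exponent of every prime of `N_U` is unchanged along an edge** (in particular the Eisenstein prime `p ‖ N` stays
`p ‖ N`): `q ∣ N_U ⇒ ν_q(N_W) = ν_q(N_U)`. Unconditional, every `p`. [cite: SilvermanAEC2009, VII.5 Prop. 5.1(c) and App. C §16] -/
theorem factorization_eq_of_dvd_of_twoStepAt {p : ℕ} {U W : WeierstrassCurve ℚ} (h : TwoStepAt p U W) {q : ℕ} (hq : q.Prime)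
    (hqU : q ∣ U.conductorNorm ℤ) : (W.conductorNorm ℤ).factorization q = (U.conductorNorm ℤ).factorization q := by
  obtain ⟨hUE, _, _, _, K, _, _, hK, hHN, -, hodd, -, -, Ud, _, _, ⟨C₁, hC₁⟩, K'', _, _, hK'', hodd'', -, hHN'', -, -,
    ⟨C₂, hC₂⟩⟩ := h
  have hF := factorization_conductorNorm_of_data hK hHN hodd hC₁ hK'' hHN'' hodd'' hC₂ (q := q) hq
  by_cases hqd : (q : ℤ) ∣ NumberField.discr K ∨ (q : ℤ) ∣ NumberField.discr K''
  · exact absurd (hF.1 hqd).1 (hq.factorization_pos_of_dvd (conductorNorm_pos_holds U).ne' hqU).ne'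
  · push Not at hqd
    exact (hF.2 hqd.1 hqd.2).symm

/-- **EXACT GRADING, granted modularity.** If `TwoStepAt p U W` then `N_W = N_U · D²` with `D = |d_K d_{K″}| ≥ 77` squarefree
and prime to `N_U`, and `W` is a model of `U ⊗ χ_{d_K d_{K″}}` — from the tree's `rootNumber_quadraticTwist_of_emod_four_eq_one`
(conductor of a twist by a discriminant prime to the level, `exists_isNewformOf`) and `conductorNorm_smul`.
[cite: SilvermanAEC2009, App. C §16] [cite: BCDTJAMS2001, Theorem A] -/
theorem exists_conductorNorm_eq_mul_sq_of_twoStepAt (hnf : exists_isNewformOf) {p : ℕ} {U W : WeierstrassCurve ℚ}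
    (h : TwoStepAt p U W) :
    ∃ D : ℤ, 0 < D ∧ Squarefree D ∧ 77 ≤ D.natAbs ∧ D.natAbs.Coprime (U.conductorNorm ℤ) ∧
      (∃ C : VariableChange ℚ, C • W = U.quadraticTwist (D : ℚ)) ∧
      W.conductorNorm ℤ = U.conductorNorm ℤ * D.natAbs ^ 2 := by
  obtain ⟨hUE, _, hWE, _, K, _, _, hK, hHN, -, hodd, hlt, -, Ud, _, _, ⟨C₁, hC₁⟩, K'', _, _, hK'', hodd'', hlt'', hHN'', -, -,
    ⟨C₂, hC₂⟩⟩ := h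
  obtain ⟨-, hsq, h77, hcop⟩ := mul_sq_dvd_conductorNorm_of_data hK hHN hodd hlt hC₁ hK'' hHN'' hodd'' hlt'' hC₂
  obtain ⟨hd4, -⟩ := discr_emod_four_eq_one_and_squarefree hK hodd
  obtain ⟨hd4'', -⟩ := discr_emod_four_eq_one_and_squarefree hK'' hodd''
  set D : ℤ := NumberField.discr K * NumberField.discr K'' with hD
  have hDabs : D.natAbs = (NumberField.discr K).natAbs * (NumberField.discr K'').natAbs := by rw [hD, Int.natAbs_mul]
  have hDpos : 0 < D := by rw [hD]; nlinarith
  have hD4 : D % 4 = 1 := by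
    rw [hD, Int.mul_emod, hd4, hd4'']; norm_num
  have hDsq : Squarefree D := by rw [← Int.squarefree_natAbs, hDabs]; exact hsq
  have hgcd : Int.gcd D (U.conductorNorm ℤ) = 1 := by
    rw [Int.gcd_eq_natAbs, Int.natAbs_natCast, hDabs]; exact hcop
  obtain ⟨C₃, hC₃⟩ := exists_smul_eq_quadraticTwist_mul hC₁ hC₂
  have hC₃' : C₃ • W = U.quadraticTwist (D : ℚ) := by rw [hC₃, hD, Int.cast_mul]
  have hN := (U.rootNumber_quadraticTwist_of_emod_four_eq_one hnf hD4 hDsq hgcd).2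
  refine ⟨D, hDpos, hDsq, by rw [hDabs]; exact h77, by rw [hDabs]; exact hcop, ⟨C₃, hC₃'⟩, ?_⟩
  have hDq : (D : ℚ) ≠ 0 := by exact_mod_cast hDpos.ne'
  haveI := U.isElliptic_quadraticTwist hDq
  rw [← hN, ← hC₃', conductorNorm_smul]

/-! ### Chains: acyclicity, and forward chains leave the isogeny class for good -/

/-- **Forward chains strictly raise the conductor**: `TransGen (TwoStepAt p) U W ⇒ N_U < N_W`. Unconditional, every `p`.
[folklore] -/
theorem conductorNorm_lt_of_transGen {p : ℕ} {U W : WeierstrassCurve ℚ} (h : Relation.TransGen (TwoStepAt p) U W) :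
    U.conductorNorm ℤ < W.conductorNorm ℤ := by
  induction h with
  | single hUW => exact conductorNorm_lt_of_twoStepAt hUW
  | tail _ hBW ih => exact ih.trans (conductorNorm_lt_of_twoStepAt hBW)

/-- **Forward chains preserve divisibility of conductors**: `ReflTransGen (TwoStepAt p) U W ⇒ N_U ∣ N_W`. [folklore] -/
theorem conductorNorm_dvd_of_reflTransGen {p : ℕ} {U W : WeierstrassCurve ℚ}
    (h : Relation.ReflTransGen (TwoStepAt p) U W) : U.conductorNorm ℤ ∣ W.conductorNorm ℤ := by
  induction h with
  | refl => exact dvd_rfl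
  | tail _ hBW ih => exact ih.trans (conductorNorm_dvd_of_twoStepAt hBW)

/-- **THE CERTIFIED TWO-STEP GRAPH IS ACYCLIC**: no non-trivial forward chain returns to its start (`¬ TransGen (TwoStepAt p) W W`;
in particular no loop `TwoStepAt p W W`). Unconditional, every `p`. [folklore] -/
theorem not_transGen_twoStepAt_self {p : ℕ} (W : WeierstrassCurve ℚ) : ¬ Relation.TransGen (TwoStepAt p) W W :=
  fun h ↦ lt_irrefl _ (conductorNorm_lt_of_transGen h)

/-- **A forward chain never returns to the isogeny class it left** (granted modularity: isogenous curves have the same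
conductor, `conductorNorm_eq_of_isIsogenous_of_modularity`). [cite: AtkinLehner1970, Thm. 4] -/
theorem not_isIsogenous_of_transGen (hmod : nonempty_modularParametrizationData) {p : ℕ} {U W : WeierstrassCurve ℚ}
    [U.IsElliptic] [W.IsElliptic] (h : Relation.TransGen (TwoStepAt p) U W) : ¬ IsIsogenous U W := fun hiso ↦ by
  have hN : U.conductorNorm ℤ = W.conductorNorm ℤ := conductorNorm_eq_of_isIsogenous_of_modularity hmod U W hiso
  have hlt := conductorNorm_lt_of_transGen h
  omega

/-- **No loops**: `¬ TwoStepAt p W W` (a special case of acyclicity). Unconditional, every `p`. [folklore] -/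
theorem not_twoStepAt_self {p : ℕ} (W : WeierstrassCurve ℚ) : ¬ TwoStepAt p W W :=
  fun h ↦ not_transGen_twoStepAt_self W (Relation.TransGen.single h)

end Summit.BirchSwinnertonDyer.BirchSwinnertonDyer.Theorems.EisensteinPrimesMazurMCOnCellBTwistbackEdgeGrading

end
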